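import Summits.ResolutionOfSingularities.ResolutionOfSingularities.Theorems.RisoStrataRisoCentresResolveLazyHeightOne

/-!
# Route RisoStrata — crux `RisoCentresResolve` (stmt-ResolutionOfSingularities-18546), line `Sketch`,
# lead c3: the ISOLATED-CENTRE STEP (every dimension) and the rtd-free lazy quadratic tower

Generic tools for the riso tower at a centre of `O` that is an ISOLATED singular point of the chart
(no hypothesis on the cut predicate `P`, any Krull dimension):

* `rcr_not_isRegularLocalRing_of_risoCen_le` — every prime containing a centre ideal
  `Cen = risoCen P B d` is singular (the regular locus of the finitely generated `B` over the
  perfect field `k` is open, so a regular prime has a basic open regular neighbourhood `D(f)`, and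
  `f` lies in every singular maximal ideal, i.e. in `Cen`).
* `rcr_mem_minimalPrimes_risoCen` — if `Cen` lies inside the centre `𝔭 = 𝔪_O ∩ B` and every prime
  strictly below `𝔭` is regular ("the punctured spectrum of `B_𝔭` is regular": `𝔭` is an isolated
  point of the singular locus), then `𝔭` is a minimal prime of `Cen`.
* `rcr_minimalPrimeStep` — the riso step at a centre that is a minimal prime of the centre ideal is
  ONE QUADRATIC TRANSFORM of `B_𝔭` along `O` (`IsQuadraticTransformAlong`): the proof of
  `stub_rcrHeightOneStep` (`…HeightOneStep.lean`, lead c1) verbatim from the minimality on — there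
  minimality came from `ht 𝔭 ≤ 1`, here it is the hypothesis (prime avoidance gives `s ∉ 𝔭` in all
  other minimal primes of the radical ideal `Cen`, so `s · 𝔭 ⊆ Cen` and the admissible denominator is
  `O`-minimal in all of `𝔭`).
* `rcr_punctured_of_locAtCentre` — isolatedness read on the local ring: if every non-maximal prime
  `Q` of `L = B_𝔭 = locAtCentre B O` has `L_Q` regular then every prime `q < 𝔭` of `B` has `B_q`
  regular (`L_Q ≅ B_q`, localisation of a localisation).
* `rcr_isolated_tower` — THE RTD-FREE TOWER THEOREM: along a valuation ring `O`, if every iterated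
  quadratic transform `R` of the local ring `R₀ = B₀_{𝔪_O ∩ B₀}` (including `R₀`) has a regular
  punctured spectrum, then for EVERY schedule and EVERY admissible choice of denominators the local
  ring at the centre of `O` of every stage is an iterated quadratic transform of `R₀` along `O`:
  each letter is either lazy (centre ideal not inside the centre of `O`: localisation at an `O`-unit,
  `lazyHeightOne_risoLoc_risoStep_eq`) or acts as the quadratic transform (`rcr_minimalPrimeStep`),
  WHATEVER the cut predicate says — no value of the typed `Rtd` is ever needed.
Consequence (`Theorems/RisoCentresResolve/Negative/…FalseOfIsolatedQuadraticLoop`): an immortal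
isolated chain (every iterated quadratic transform non-regular, punctured-regular) refutes the crux.
-/

noncomputable section

set_option linter.dupNamespace false -- mandated namespace of this single-conjunct summit

namespace Summit.ResolutionOfSingularities.ResolutionOfSingularities.Theorems

open Literature.AlgebraicGeometry.Resolution IsLocalRing

section Generic

variable {k K : Type} [Field k] [Field K] [Algebra k K]

/-- The centre ideal `risoCen P B d` is radical: it is an intersection of maximal ideals.
(adapted from `…HeightOneStep.lean`, where it is private) [folklore] -/
theorem rcrIso_isRadical_risoCen
    (P : ∀ B : Subalgebra k K, Ideal ↥B → ℕ → Prop) (B : Subalgebra k K) (d : ℕ) :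
    (risoCen P B d).IsRadical :=
  Ideal.isRadical_iInf _ fun _ => Ideal.isRadical_iInf _ fun hm => hm.fst.isPrime.isRadical

/-- **Prime avoidance among minimal primes**: if `I` has finitely many minimal primes and `p` is
one of them, some `u ∉ p` lies in every other minimal prime of `I`.
(adapted from `…HeightOneStep.lean`, where it is private) [folklore] -/
theorem rcrIso_exists_not_mem_of_mem_minimalPrimes {A : Type*} [CommRing A]
    {I p : Ideal A} (hfin : I.minimalPrimes.Finite) (hp : p ∈ I.minimalPrimes) :
    ∃ u : A, u ∉ p ∧ ∀ q ∈ I.minimalPrimes, q ≠ p → u ∈ q := by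
  classical
  set F : Finset (Ideal A) := hfin.toFinset.erase p with hF
  have hFmem : ∀ q, q ∈ F ↔ q ∈ I.minimalPrimes ∧ q ≠ p := fun q => by
    rw [hF, Finset.mem_erase, Set.Finite.mem_toFinset, and_comm]
  have hnot : ¬ F.inf id ≤ p := by
    intro hle
    obtain ⟨q, hqF, hqp⟩ := (Ideal.IsPrime.inf_le' hp.1.1).mp hle
    obtain ⟨hqS, hqne⟩ := (hFmem q).mp hqF
    exact hqne (le_antisymm hqp (hp.2 hqS.1 hqp))
  obtain ⟨u, huF, hup⟩ := Set.not_subset.mp hnot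
  refine ⟨u, hup, fun q hqS hqne => ?_⟩
  have : u ∈ F.inf id := huF
  rw [Submodule.mem_finsetInf] at this
  exact this q ((hFmem q).mpr ⟨hqS, hqne⟩)

/-- **Primes over a centre ideal are singular.** For a finitely generated `k`-subalgebra `B`
(`k` algebraically closed) and a prime `q ⊇ risoCen P B d`, the local ring `B_q` is not regular:
otherwise the open regular locus (`isOpen_regularLocus_of_perfectField`) contains a basic open
`D(f) ∋ q`, and `f` lies in every singular maximal ideal, hence in `risoCen P B d ⊆ q` —
contradicting `f ∉ q`. [folklore] -/
theorem rcr_not_isRegularLocalRing_of_risoCen_le [IsAlgClosed k]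
    (P : ∀ B : Subalgebra k K, Ideal ↥B → ℕ → Prop) (B : Subalgebra k K) (hB : B.FG) (d : ℕ)
    (q : Ideal ↥B) [hq : q.IsPrime] (hle : risoCen P B d ≤ q) :
    ¬ IsRegularLocalRing (Localization.AtPrime q) := by
  classical
  haveI : Algebra.FiniteType k ↥B := (Subalgebra.fg_iff_finiteType B).mp hB
  have hopen : IsOpen (regularLocus ↥B) := isOpen_regularLocus_of_perfectField k ↥B
  intro hreg
  let Q : PrimeSpectrum ↥B := ⟨q, hq⟩
  have hQ : Q ∈ regularLocus ↥B := hreg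
  obtain ⟨_, ⟨f, rfl⟩, hQf, hfU⟩ :=
    PrimeSpectrum.isTopologicalBasis_basic_opens.exists_subset_of_mem_open hQ hopen
  have hfq : f ∉ q := (PrimeSpectrum.mem_basicOpen _ _).mp hQf
  apply hfq
  apply hle
  unfold risoCen
  simp only [Submodule.mem_iInf]
  rintro m ⟨hm, hsing, -⟩
  by_contra hfm
  apply hsing
  have hmem : (⟨m, hm.isPrime⟩ : PrimeSpectrum ↥B) ∈ regularLocus ↥B :=
    hfU ((PrimeSpectrum.mem_basicOpen _ _).mpr hfm)
  exact hmem

/-- **An isolated singular centre is a minimal prime of the centre ideal.** Let `B ⊆ O` be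
finitely generated (`k` algebraically closed) with centre `𝔭 = 𝔪_O ∩ B`, let the centre ideal
`risoCen P B d` lie inside `𝔭`, and let every prime `q < 𝔭` have `B_q` regular. Then `𝔭` is a
minimal prime of `risoCen P B d` (a prime between `Cen` and `𝔭` is singular by
`rcr_not_isRegularLocalRing_of_risoCen_le`). [folklore] -/
theorem rcr_mem_minimalPrimes_risoCen [IsAlgClosed k]
    (P : ∀ B : Subalgebra k K, Ideal ↥B → ℕ → Prop) (d : ℕ)
    (B : Subalgebra k K) (hB : B.FG) (O : ValuationSubring K) (hBO : B.toSubring ≤ O.toSubring)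
    (hCen : ∀ a ∈ risoCen P B d, O.valuation ((a : ↥B) : K) < 1)
    (hiso : ∀ (q : Ideal ↥B) [q.IsPrime], q < subringCentre B.toSubring O hBO →
      IsRegularLocalRing (Localization.AtPrime q)) :
    (subringCentre B.toSubring O hBO : Ideal ↥B) ∈ (risoCen P B d).minimalPrimes := by
  set p : Ideal ↥B := subringCentre B.toSubring O hBO
  haveI hpprime : p.IsPrime := subringCentre.isPrime B.toSubring O hBO
  have hCenp : risoCen P B d ≤ p := fun a ha => (mem_subringCentre_iff hBO a).mpr (hCen a ha)
  refine ⟨⟨hpprime, hCenp⟩, fun q hq hqp => ?_⟩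
  obtain ⟨hqprime, hCenq⟩ := hq
  by_contra hpq
  have hlt : q < p := lt_of_le_of_ne hqp fun h => hpq (h ▸ le_rfl)
  haveI := hqprime
  exact rcr_not_isRegularLocalRing_of_risoCen_le P B hB d q hCenq (hiso q hlt)

/-- **Prime avoidance at a centre that is a minimal prime of the centre ideal.** Some `s ∈ B` of
value `1` multiplies `𝔭 = 𝔪_O ∩ B` into `Cen = risoCen P B d` (`Cen` is radical, so the
intersection of its finitely many minimal primes; take `s ∉ 𝔭` in all the others).
(adapted from `…HeightOneStep.lean`, `rcrH1_exists_avoid`, with minimality as hypothesis)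
[folklore] -/
theorem rcrIso_exists_avoid
    (P : ∀ B : Subalgebra k K, Ideal ↥B → ℕ → Prop) (d : ℕ)
    (B : Subalgebra k K) (hB : B.FG) (O : ValuationSubring K) (hBO : B.toSubring ≤ O.toSubring)
    (hpmin : (subringCentre B.toSubring O hBO : Ideal ↥B) ∈ (risoCen P B d).minimalPrimes) :
    ∃ s : ↥B, O.valuation (s : K) = 1 ∧
      ∀ a : ↥B, O.valuation (a : K) < 1 → s * a ∈ risoCen P B d := by
  classical
  haveI : IsNoetherianRing ↥B := isNoetherianRing_of_fg hB
  set p : Ideal ↥B := subringCentre B.toSubring O hBO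
  haveI hpprime : p.IsPrime := subringCentre.isPrime B.toSubring O hBO
  have hmem : ∀ a : ↥B, a ∈ p ↔ O.valuation (a : K) < 1 := fun a =>
    mem_subringCentre_iff hBO a
  have hrad : (risoCen P B d).radical = risoCen P B d := (rcrIso_isRadical_risoCen P B d).radical
  obtain ⟨s, hsp, hs⟩ := rcrIso_exists_not_mem_of_mem_minimalPrimes
    (Ideal.finite_minimalPrimes_of_isNoetherianRing ↥B (risoCen P B d)) hpmin
  refine ⟨s, valuation_eq_one_of_not_mem_subringCentre hBO hsp, fun a ha => ?_⟩
  have hsa : s * a ∈ sInf (risoCen P B d).minimalPrimes := by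
    rw [Ideal.mem_sInf]
    intro q hq
    by_cases hqp : q = p
    · rw [hqp]
      exact p.mul_mem_left s ((hmem a).mpr ha)
    · exact q.mul_mem_right a (hs q hq hqp)
  rwa [Ideal.sInf_minimalPrimes, hrad] at hsa

/-- **The riso step at a centre that is a minimal prime of the centre ideal is one quadratic
transform** (every Krull dimension, no hypothesis on the cut predicate). Let `B ⊆ O` be a finitely
generated chart whose centre `𝔭 = 𝔪_O ∩ B` is a minimal prime of `Cen = risoCen P B d` (e.g. an
isolated singular closed point, `rcr_mem_minimalPrimes_risoCen`, or a centre of height `≤ 1`,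
`stub_rcrHeightOneStep`). For an admissible denominator `x` the chart `B[Cen/x]` localised at the
centre of `O` is the quadratic transform of `B_𝔭` along `O`: by avoidance `x` is `O`-minimal in
all of `𝔭`, hence a generator of minimal value of `𝔪_{B_𝔭}`, and `k[B ∪ Cen·x⁻¹]` and
`B_𝔭[𝔪/x]` have the same local ring at the centre of `O`.
(proof adapted verbatim from `stub_rcrHeightOneStep`, lead c1) [folklore] -/
theorem rcr_minimalPrimeStep
    (P : ∀ B : Subalgebra k K, Ideal ↥B → ℕ → Prop) (d : ℕ)
    (B : Subalgebra k K) (hB : B.FG) (O : ValuationSubring K) (hBO : B.toSubring ≤ O.toSubring)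
    (hCen : ∀ a ∈ risoCen P B d, O.valuation ((a : ↥B) : K) < 1)
    (hpmin : (subringCentre B.toSubring O hBO : Ideal ↥B) ∈ (risoCen P B d).minimalPrimes)
    (xt : K) (hx : risoValid P O B d xt) :
    IsQuadraticTransformAlong O (risoLoc O B).toSubring
      (risoLoc O (risoStep P B d xt)).toSubring := by
  classical
  -- the avoidance element at the centre prime
  obtain ⟨s, hsv, hsCen⟩ := rcrIso_exists_avoid P d B hB O hBO hpmin
  obtain ⟨hxt0, ⟨x₀, hx₀Cen, hx₀eq⟩, hadm⟩ := id hx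
  have hs0 : (s : K) ≠ 0 := ne_zero_of_valuation_eq_one hsv
  have hS₁O : (risoStep P B d xt).toSubring ≤ O.toSubring := risoStep_toSubring_le hBO hx
  have hBS₁ : B.toSubring ≤ (risoStep P B d xt).toSubring := fun z hz => le_risoStep P B d xt hz
  have hxtB : xt ∈ B.toSubring := hx₀eq ▸ x₀.2
  -- `xt` has minimal value in the whole centre prime `𝔪_O ∩ B`
  have hvxt : O.valuation xt < 1 := hx₀eq ▸ hCen x₀ hx₀Cen
  have hxtpos : 0 < O.valuation xt := by
    rw [pos_iff_ne_zero]
    simpa using hxt0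
  have hmin : ∀ a : ↥B, O.valuation (a : K) < 1 → O.valuation (a : K) ≤ O.valuation xt := by
    intro a ha
    have h : (s : K) * (a : K) * xt⁻¹ ∈ O := by
      have := hadm (s * a) (hsCen a ha)
      rwa [MulMemClass.coe_mul] at this
    rw [← O.valuation_le_one_iff, map_mul, map_mul, hsv, one_mul, map_inv₀,
      mul_inv_le_iff₀ hxtpos, one_mul] at h
    exact h
  -- the source is `L = B_{𝔪_O ∩ B}`, a Noetherian local ring
  rw [risoLoc_toSubring_eq hBO, risoLoc_toSubring_eq hS₁O]
  set L := locAtCentre B.toSubring O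
  haveI hLloc : IsLocalRing L := isLocalRing_locAtCentre hBO
  haveI := isLocalization_locAtCentre hBO
  haveI : IsNoetherianRing L :=
    IsLocalization.isNoetherianRing (subringCentre B.toSubring O hBO).primeCompl L
      (isNoetherianRing_of_fg hB)
  -- values on the maximal ideal of `L` are bounded below by the value of `xt`
  have hLval : ∀ y : L, y ∈ maximalIdeal L → O.valuation (y : K) ≤ O.valuation xt := by
    intro y hy
    have hy' := (mem_maximalIdeal_locAtCentre_iff hBO y).mp hy
    obtain ⟨a, ha, z, hz, hvz, hyeq⟩ := (mem_locAtCentre_iff).mp y.2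
    rw [hyeq, map_div₀, hvz, div_one] at hy' ⊢
    exact hmin ⟨a, ha⟩ hy'
  -- for `y ∈ 𝔪_L`, `y / xt` lies in the local ring of the chart at the centre of `O`
  have hkeyS : ∀ y : L, y ∈ maximalIdeal L →
      (y : K) / xt ∈ locAtCentre (risoStep P B d xt).toSubring O := by
    intro y hy
    have hy' := (mem_maximalIdeal_locAtCentre_iff hBO y).mp hy
    obtain ⟨a, ha, z, hz, hvz, hyeq⟩ := (mem_locAtCentre_iff).mp y.2
    have hva : O.valuation a < 1 := by rwa [hyeq, map_div₀, hvz, div_one] at hy'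
    have hz0 : z ≠ 0 := ne_zero_of_valuation_eq_one hvz
    refine ⟨(s : K) * a * xt⁻¹, ?_, (s : K) * z, ?_, ?_, ?_⟩
    · have := mul_inv_mem_risoStep P (xt := xt) (hsCen ⟨a, ha⟩ hva)
      simpa only [MulMemClass.coe_mul, Subalgebra.mem_toSubring] using this
    · exact hBS₁ (B.mul_mem s.2 hz)
    · rw [map_mul, hsv, hvz, one_mul]
    · rw [hyeq]
      field_simp
  -- generators of `𝔪_L`: a finite generating set together with `xt`
  obtain ⟨u', hu'⟩ : ∃ u' : Finset L, Ideal.span (↑u' : Set L) = maximalIdeal L :=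
    IsNoetherian.noetherian (maximalIdeal L)
  set x₁ : L := ⟨xt, le_locAtCentre _ O hxtB⟩
  have hx₁max : x₁ ∈ maximalIdeal L := (mem_maximalIdeal_locAtCentre_iff hBO x₁).mpr hvxt
  have hspan : Ideal.span (↑(insert x₁ u') : Set L) = maximalIdeal L := by
    rw [Finset.coe_insert, Ideal.span_insert, hu', sup_eq_right]
    exact (Ideal.span_singleton_le_iff_mem _).mpr hx₁max
  have hx₁0 : x₁ ≠ 0 := fun h => hxt0 (congrArg Subtype.val h)
  have hval :
      ∀ y ∈ insert x₁ u', O.valuation ((y : L) : K) ≤ O.valuation ((x₁ : L) : K) := by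
    intro y hy
    refine hLval y ?_
    rw [← hspan]
    exact Ideal.subset_span (Finset.mem_coe.mpr hy)
  refine ⟨hLloc, locAtCentre_le hBO, insert x₁ u', x₁, hspan, Finset.mem_insert_self _ _,
    hx₁0, hval, ?_⟩
  -- the ring equality: both rings have the same local ring at the centre of `O`
  show locAtCentre (risoStep P B d xt).toSubring O =
    locAtCentre (Subring.closure
      ((L : Set K) ∪ (fun y : L => (y : K) / (x₁ : K)) '' ↑(insert x₁ u'))) O
  set C := Subring.closure
    ((L : Set K) ∪ (fun y : L => (y : K) / (x₁ : K)) '' ↑(insert x₁ u'))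
  -- every element of `𝔪_L`, divided by `xt`, lies in `C`
  have hkeyC : ∀ y : L, y ∈ maximalIdeal L → (y : K) / xt ∈ C := by
    intro y hy
    rw [← hspan] at hy
    induction hy using Submodule.span_induction with
    | mem y hy => exact Subring.subset_closure (Or.inr ⟨y, hy, rfl⟩)
    | zero => simp
    | add y y' _ _ hy hy' => rw [Subring.coe_add, add_div]; exact C.add_mem hy hy'
    | smul a y _ hy =>
      rw [smul_eq_mul, Subring.coe_mul, mul_div_assoc]
      exact C.mul_mem (Subring.subset_closure (Or.inl a.2)) hy
  -- the chart lies in `C_{𝔪_O ∩ C}`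
  have hE1 : (risoStep P B d xt).toSubring ≤ locAtCentre C O := by
    let LC : Subalgebra k K :=
      { locAtCentre C O with
        algebraMap_mem' := fun c => le_locAtCentre C O
          (Subring.subset_closure (Or.inl (le_locAtCentre B.toSubring O (B.algebraMap_mem c)))) }
    have hle : risoStep P B d xt ≤ LC := by
      refine Algebra.adjoin_le ?_
      rintro y (hy | ⟨a, ha, rfl⟩)
      · exact le_locAtCentre C O
          (Subring.subset_closure (Or.inl (le_locAtCentre B.toSubring O hy)))
      · have ha' : (⟨(a : K), le_locAtCentre B.toSubring O a.2⟩ : L) ∈ maximalIdeal L :=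
          (mem_maximalIdeal_locAtCentre_iff hBO _).mpr (hCen a ha)
        have := le_locAtCentre C O (hkeyC _ ha')
        rwa [← div_eq_mul_inv]
    exact fun y hy => hle hy
  -- `C` lies in the local ring of the chart at the centre of `O`
  have hE2 : C ≤ locAtCentre (risoStep P B d xt).toSubring O := by
    refine Subring.closure_le.mpr ?_
    rintro y (hy | ⟨y', hy', rfl⟩)
    · exact locAtCentre_mono O hBS₁ hy
    · refine hkeyS y' ?_
      rw [← hspan]
      exact Ideal.subset_span hy'
  apply le_antisymm
  · calc locAtCentre (risoStep P B d xt).toSubring O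
        ≤ locAtCentre (locAtCentre C O) O := locAtCentre_mono O hE1
      _ = locAtCentre C O := locAtCentre_locAtCentre C O
  · calc locAtCentre C O
        ≤ locAtCentre (locAtCentre (risoStep P B d xt).toSubring O) O := locAtCentre_mono O hE2
      _ = locAtCentre (risoStep P B d xt).toSubring O := locAtCentre_locAtCentre _ O

/-- **Isolatedness read on the local ring.** Let `B ⊆ O` be a subring with centre
`𝔭 = 𝔪_O ∩ B` and `L = locAtCentre B O = B_𝔭`. If every prime `Q` of `L` missing some element of
value `< 1` (i.e. `Q ≠ 𝔪_L`) has `L_Q` regular, then every prime `q < 𝔭` of `B` has `B_q` regular: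
`B_q ≅ L_{qL}` (localisation of a localisation, `IsLocalization.algEquiv`). [folklore] -/
theorem rcr_punctured_of_locAtCentre
    (B : Subring K) (O : ValuationSubring K) (hBO : B ≤ O.toSubring)
    (hL : ∀ (Q : Ideal ↥(locAtCentre B O)) [Q.IsPrime],
      (∃ r : ↥(locAtCentre B O), O.valuation (r : K) < 1 ∧ r ∉ Q) →
      IsRegularLocalRing (Localization.AtPrime Q))
    (q : Ideal ↥B) [hq : q.IsPrime] (hlt : q < subringCentre B O hBO) :
    IsRegularLocalRing (Localization.AtPrime q) := by
  set p : Ideal ↥B := subringCentre B O hBO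
  haveI hp : p.IsPrime := subringCentre.isPrime B O hBO
  set L := locAtCentre B O
  haveI := isLocalization_locAtCentre hBO
  -- `q` is disjoint from `B ∖ 𝔭`
  have hdisj : Disjoint (p.primeCompl : Set ↥B) q := by
    rw [Set.disjoint_left]
    intro r hr hrq
    exact hr (hlt.le hrq)
  set Q : Ideal ↥L := q.map (algebraMap ↥B ↥L)
  haveI hQ : Q.IsPrime := IsLocalization.isPrime_of_isPrime_disjoint p.primeCompl ↥L q hq hdisj
  have hunder : Q.comap (algebraMap ↥B ↥L) = q :=
    IsLocalization.under_map_of_isPrime_disjoint p.primeCompl ↥L hq hdisj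
  -- `Q ≠ 𝔪_L`: an element of `𝔭 ∖ q` has value `< 1` and does not lie in `Q`
  obtain ⟨r, hrp, hrq⟩ := Set.exists_of_ssubset hlt
  have hreg : IsRegularLocalRing (Localization.AtPrime Q) := by
    refine hL Q ⟨algebraMap ↥B ↥L r, ?_, fun hrQ => hrq ?_⟩
    · rw [locAtCentre.algebraMap_apply]
      exact (mem_subringCentre_iff hBO r).mp hrp
    · have : r ∈ Q.comap (algebraMap ↥B ↥L) := hrQ
      rwa [hunder] at this
  -- `L_Q ≅ B_q`
  haveI h1 : IsLocalization.AtPrime (Localization.AtPrime Q) (Q.comap (algebraMap ↥B ↥L)) :=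
    IsLocalization.isLocalization_isLocalization_atPrime_isLocalization p.primeCompl
      (T := Localization.AtPrime Q) Q
  have hM : q.primeCompl = (Q.comap (algebraMap ↥B ↥L)).primeCompl := by
    ext r
    change r ∉ q ↔ r ∉ Q.comap (algebraMap ↥B ↥L)
    rw [hunder]
  haveI h2 : IsLocalization q.primeCompl (Localization.AtPrime Q) := by
    rw [hM]; exact h1
  have e : Localization.AtPrime Q ≃+* Localization.AtPrime q :=
    (IsLocalization.algEquiv q.primeCompl (Localization.AtPrime Q)
      (Localization.AtPrime q)).toRingEquiv
  exact IsRegularLocalRing.of_ringEquiv e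

/-- **The rtd-free lazy quadratic tower.** Let `B₀ ⊆ O` be finitely generated (`k` algebraically
closed) and suppose that EVERY iterated quadratic transform `R` along `O` of the local ring
`R₀ = locAtCentre B₀ O` at the centre of `O` (including `R₀` itself) has a regular punctured
spectrum (every prime `Q ≠ 𝔪_R` has `R_Q` regular). Then along EVERY schedule `sched`, for EVERY
choice of denominators `x` admissible below stage `t ≤ |sched|`, the local ring at the centre of
`O` of stage `t` is an iterated quadratic transform of `R₀` along `O` — whatever the cut predicate
`P` is: at each letter either the centre ideal is not inside the centre of `O` and the step is lazy
(`lazyHeightOne_risoLoc_risoStep_eq`), or it is, the centre is then a minimal prime of the centre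
ideal (`rcr_mem_minimalPrimes_risoCen`, isolatedness) and the step is the quadratic transform
(`rcr_minimalPrimeStep`). [folklore] -/
theorem rcr_isolated_tower [IsAlgClosed k]
    (P : ∀ B : Subalgebra k K, Ideal ↥B → ℕ → Prop)
    (B₀ : Subalgebra k K) (hB₀ : B₀.FG) (O : ValuationSubring K)
    (hB₀O : B₀.toSubring ≤ O.toSubring)
    (hiso : ∀ R : Subring K,
      Relation.ReflTransGen (IsQuadraticTransformAlong O) (locAtCentre B₀.toSubring O) R →
        ∀ (Q : Ideal ↥R) [Q.IsPrime], (∃ r : ↥R, O.valuation (r : K) < 1 ∧ r ∉ Q) →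
          IsRegularLocalRing (Localization.AtPrime Q))
    (sched : List ℕ) (x : ℕ → K) (t : ℕ) (ht : t ≤ sched.length)
    (hadm : ∀ s, s < t → risoValid P O (risoStage P B₀ sched x s) (sched.getD s 0) (x s)) :
    Relation.ReflTransGen (IsQuadraticTransformAlong O) (locAtCentre B₀.toSubring O)
      (risoLoc O (risoStage P B₀ sched x t)).toSubring := by
  induction t with
  | zero =>
    rw [risoStage_zero, risoLoc_toSubring_eq hB₀O]
  | succ t ih =>
    have ht' : t < sched.length := Nat.lt_of_succ_le ht
    have hadm' : ∀ s, s < t → risoValid P O (risoStage P B₀ sched x s) (sched.getD s 0) (x s) :=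
      fun s hs => hadm s (Nat.lt_succ_of_lt hs)
    have ih' := ih ht'.le hadm'
    -- stage `t` is finitely generated and lies in `O`
    have hfg : (risoStage P B₀ sched x t).FG := risoStage_fg hB₀ t
    have hle : (risoStage P B₀ sched x t).toSubring ≤ O.toSubring :=
      risoStage_toSubring_le hB₀O (fun s hs _ => hadm' s hs)
    have hV : risoValid P O (risoStage P B₀ sched x t) (sched.getD t 0) (x t) :=
      hadm t (Nat.lt_succ_self t)
    rw [risoStage_succ P B₀ sched x ht']
    by_cases hCen : ∀ a ∈ risoCen P (risoStage P B₀ sched x t) (sched.getD t 0),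
        O.valuation ((a : ↥(risoStage P B₀ sched x t)) : K) < 1
    · -- acting letter: the centre is an isolated point of the centre locus ⇒ quadratic transform
      refine ih'.tail ?_
      have hloc := risoLoc_toSubring_eq (k := k) hle
      have ih'' : Relation.ReflTransGen (IsQuadraticTransformAlong O) (locAtCentre B₀.toSubring O)
          (locAtCentre (risoStage P B₀ sched x t).toSubring O) := by
        rw [← hloc]; exact ih'
      have hpunct : ∀ (q : Ideal ↥(risoStage P B₀ sched x t)) [q.IsPrime],
          q < subringCentre (risoStage P B₀ sched x t).toSubring O hle →
            IsRegularLocalRing (Localization.AtPrime q) := fun q _ hq =>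
        rcr_punctured_of_locAtCentre (risoStage P B₀ sched x t).toSubring O hle
          (fun Q _ hQ => hiso _ ih'' Q hQ) q hq
      have hpmin := rcr_mem_minimalPrimes_risoCen P (sched.getD t 0) _ hfg O hle hCen hpunct
      exact rcr_minimalPrimeStep P (sched.getD t 0) _ hfg O hle hCen hpmin (x t) hV
    · -- lazy letter: the local ring does not change
      rw [lazyHeightOne_risoLoc_risoStep_eq P hle hV hCen]
      exact ih'

end Generic

end Summit.ResolutionOfSingularities.ResolutionOfSingularities.Theorems

end
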